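import Summits.HodgeConjecture.HodgeConjecture.Theorems.MarkmanPartnerTransportPicardThreeK3SquaresHighPicard

/-!
# Route MarkmanPartnerTransport · crux `PicardThreeK3Squares` (stmt-HodgeConjecture-19652) —
# the Picard numbers at which real multiplication can occur: `22 - ρ(S) = e · m`, `e ≥ 2`, `m ≥ 3`

Sequel to `Theorems/…HighPicard` (the rung `ρ(S) ≥ 17`). Van Geemen's Lemma 3.2 in full strength says
`dim_ℚ T(S) = [E : ℚ] · dim_E T(S)` with `dim_E T(S) ≥ 3` when `E = End_Hdg(T(S)_ℚ)` is totally real;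
so REAL MULTIPLICATION (`E` totally real, `E ≠ ℚ`) forces `22 - ρ(S) = e · m` with `e ≥ 2`, `m ≥ 3`
— for `ρ(S) ≥ 3` exactly `ρ(S) ∈ {4, 6, 7, 8, 10, 12, 13, 14, 16}` (van Geemen–Schütt 2025, §2.1:
`d = nm`, `m ≥ 3`). At every other Picard number `E = ℚ` or `E` is CM, and the crux holds there
modulo Buskin's Thm. 1.1 and markings. This file proves, sorry-free:

* `exists_three_le_finrank_eq_mul` (abstract carriers) — for an irreducible polarized Hodge structure
  of K3 type with `E = End_Hdg(V)` a totally real field: `dim_ℚ V = dim_ℚ E · m` for some `m ≥ 3`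
  (tower law `Module.finrank_mul_finrank` + the tree's THEOREM
  `Vangeemen2008_three_mul_finrank_endAlg_le_holds`); `endAlg_eq_bot_or_exists_conj_ne_of_forall_mul_ne`
  — if `dim_ℚ V ≠ e · m` for all `e ≥ 2`, `m ≥ 3`, then `E = ℚ` or some embedding of `E` is non-real.
* `scalar_or_hasComplexMultiplication_of_forall_mul_add_ne` — for a projective K3 surface `S` with
  `e · m + ρ(S) ≠ 22` for all `e ≥ 2`, `m ≥ 3`: `End_Hdg(T(S)) = ℚ` (scalar clause) or
  `HasComplexMultiplication S` (marking picture of `…HighPicard`, with the EXACT count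
  `dim_ℚ N_ℚ = dim_ℂ N¹H²(S(ℂ); ℂ)`: rational divisor vectors independent over `ℚ` stay independent
  over `ℂ`, `ι_{N_ℚ}` injective).
The consequences (HC for `S × S` mod Buskin + markings off the ranks `e · m`, in particular at
`ρ(S) ∈ {3, 5, 9, 11, 15, 17, 18, 19, 20}`, and the crux reduced to `ρ(S) ∈ {4,6,7,8,10,12,13,14,16}`)
are in the sequel `Theorems/…RealMultiplicationRanksCorollaries`.

No definition, no sorry; named facts only as hypotheses. Prover seat hodge-nonav-19652-p1 (gen 0),
`--supports stmt-HodgeConjecture-19652`.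

References: van Geemen, Michigan Math. J. 56 (2008), Lemma 3.2; van Geemen–Schütt, Forum Math. Sigma
13 (2025) e2, §2.1; Zarhin, J. reine angew. Math. 341 (1983), Thm. 1.5.1; Buskin, J. reine angew.
Math. 755 (2019), Thm. 1.1.
-/

set_option linter.dupNamespace false

noncomputable section

universe u

namespace Summit.HodgeConjecture.HodgeConjecture.Theorems.MarkmanPartnerTransport.RealMultiplicationRanks

open scoped Manifold TensorProduct
open Module CategoryTheory MonoidalCategory CartesianMonoidalCategory
open Literature.AlgebraicGeometry Literature.AlgebraicGeometry.Motives Literature.AlgebraicGeometry.HodgeTheory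
open Literature.AlgebraicGeometry.Motives.HodgeStructure
open Literature.AlgebraicGeometry.Surfaces
open Literature.AlgebraicTopology.SingularHomology
open Summit.HodgeConjecture.HodgeConjecture.Theorems
open Summit.HodgeConjecture.HodgeConjecture.Theorems.NikulinTwinTransport
open Summit.HodgeConjecture.HodgeConjecture.Theorems.AnchorExistenceCMFloor

/-- `Corr[μ, hS ; γ, y] = pr₁_*(pr₂^* y ∪ γ)` on `H²(S(ℂ); ℂ)`. Local notation only. -/
local notation3 (prettyPrint := false) "Corr[" μ ", " hS " ; " γ ", " y "]" =>
  complexGysin μ (IsSmoothProjective.tensor_holds hS hS) hS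
    (SemiCartesianMonoidalCategory.fst _ _) (rfl : 2 * 1 + 2 * 2 + 2 * 2 = 2 * 1 + 2 * (2 + 2))
    (cupProduct (rfl : 2 * 1 + 2 * 2 = 2 * 1 + 2 * 2)
      (complexBetti.map (SemiCartesianMonoidalCategory.snd _ _) (2 * 1) y) γ)

/-! ### Abstract carriers: `dim_ℚ V = [E : ℚ] · m` with `m ≥ 3` in the totally real case -/

section Abstract

variable {V : Type u} [AddCommGroup V] [Module ℚ V] [Module.Finite ℚ V] {H : HodgeStructure V 2}

/-- **van Geemen's Lemma 3.2 with the tower law**: for `H` irreducible of K3 type, polarized, with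
`E = End_Hdg(V)` a field all of whose embeddings are real, `dim_ℚ V = dim_ℚ E · m` for some `m ≥ 3`
(`m = dim_E V`: `V` is an `E`-vector space, `Module.finrank_mul_finrank`; `3 · dim_ℚ E ≤ dim_ℚ V` is the
tree's theorem `Vangeemen2008_three_mul_finrank_endAlg_le_holds`). [cite: Vangeemen2008, Lemma 3.2] -/
theorem exists_three_le_finrank_eq_mul (hirr : H.IsIrreducible) (hK3 : H.IsOfK3Type) (ψ : H.Polarization)
    (hF : IsField H.endAlg) (hreal : ∀ (φ : H.endAlg →+* ℂ) (a : H.endAlg), starRingEnd ℂ (φ a) = φ a) :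
    ∃ m : ℕ, 3 ≤ m ∧ Module.finrank ℚ V = Module.finrank ℚ H.endAlg * m := by
  classical
  letI : Field H.endAlg := hF.toField
  haveI : IsScalarTower ℚ H.endAlg V := ⟨fun q a v => by
    show ((q • a : H.endAlg) : Module.End ℚ V) v = q • ((a : Module.End ℚ V) v)
    rw [Subalgebra.coe_smul, LinearMap.smul_apply]⟩
  haveI : Module.Finite ℚ H.endAlg := finiteDimensional_endAlg H
  haveI : Module.Finite H.endAlg V := Module.Finite.of_restrictScalars_finite ℚ H.endAlg V
  haveI : Nontrivial V := hirr.nontrivial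
  have htower : Module.finrank ℚ H.endAlg * Module.finrank H.endAlg V = Module.finrank ℚ V :=
    Module.finrank_mul_finrank ℚ H.endAlg V
  have h3 := Vangeemen2008_three_mul_finrank_endAlg_le_holds H hirr hK3 ⟨ψ⟩ hF hreal
  have h1 := one_le_finrank_endAlg H
  refine ⟨Module.finrank H.endAlg V, ?_, htower.symm⟩
  by_contra hlt
  have hle : Module.finrank H.endAlg V ≤ 2 := by omega
  have := Nat.mul_le_mul_left (Module.finrank ℚ H.endAlg) hle
  omega

/-- **If `dim_ℚ V` is not of the form `e · m` with `e ≥ 2`, `m ≥ 3`, then `E = ℚ` or `E` is not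
totally real** (hence CM, by Zarhin): from `exists_three_le_finrank_eq_mul`, total reality gives
`dim V = dim E · m`, `m ≥ 3`, so `dim E = 1`, i.e. `End_Hdg(V) = ℚ · id`
(`Subalgebra.eq_bot_of_finrank_one`). Covers `dim V ≤ 5` (`…HighPicard`) and `dim V` prime.
[cite: Vangeemen2008, Lemma 3.2] [cite: GeemenSchutt2023, §2.1] -/
theorem endAlg_eq_bot_or_exists_conj_ne_of_forall_mul_ne (hirr : H.IsIrreducible) (hK3 : H.IsOfK3Type)
    (ψ : H.Polarization) (hF : IsField H.endAlg)
    (hV : ∀ e m : ℕ, 2 ≤ e → 3 ≤ m → e * m ≠ Module.finrank ℚ V) :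
    H.endAlg = ⊥ ∨ ∃ (φ : H.endAlg →+* ℂ) (a : H.endAlg), starRingEnd ℂ (φ a) ≠ φ a := by
  by_cases hreal : ∀ (φ : H.endAlg →+* ℂ) (a : H.endAlg), starRingEnd ℂ (φ a) = φ a
  · left
    haveI : Nontrivial V := hirr.nontrivial
    obtain ⟨m, hm, hdim⟩ := exists_three_le_finrank_eq_mul hirr hK3 ψ hF hreal
    have h1 := one_le_finrank_endAlg H
    have he : Module.finrank ℚ H.endAlg = 1 := by
      by_contra hne
      exact hV (Module.finrank ℚ H.endAlg) m (by omega) hm hdim.symm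
    exact Subalgebra.eq_bot_of_finrank_one he
  · push Not at hreal
    exact Or.inr hreal

end Abstract

variable {S : SchemeOver ℂ}

/-! ### K3 surfaces: `End_Hdg(T(S)) = ℚ` or complex multiplication off the ranks `e · m` -/

/-- **For a projective K3 surface whose transcendental rank `22 - ρ(S)` is NOT of the form `e · m`
with `e ≥ 2`, `m ≥ 3`, `End_Hdg(T(S))` is `ℚ` or `S` has complex multiplication** (granted
markings). Marking picture as in `HighPicard.scalar_or_hasComplexMultiplication_of_seventeen_le`, with
the exact count `dim_ℚ N_ℚ = dim_ℂ N¹H² = ρ(S)` (the rational divisor vectors `N_ℚ ≤ Λ_ℚ` span `N¹H²`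
over `ℂ` and a `ℚ`-basis of `N_ℚ` is `ℂ`-independent, `ι_{N_ℚ} : ℂ ⊗_ℚ N_ℚ ↪ Λ_ℂ`), so
`dim_ℚ T = 22 - ρ(S)`; then `endAlg_eq_bot_or_exists_conj_ne_of_forall_mul_ne` on the transcendental
Hodge structure `hodgeT`, and the two translations back to `H²(S)` (`restrict_mem_endAlg` for the
scalar clause; `extendT` and Zarhin's adjoint theorem for the CM endomorphism).
[cite: Vangeemen2008, Lemma 3.2] [cite: Zarhin1983HodgeGroupsK3, Thm. 1.5.1]
[cite: Huybrechts2016K3, Ch. 3 Lemma 3.3.1 and Thm. 3.3.7] -/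
theorem scalar_or_hasComplexMultiplication_of_forall_mul_add_ne (hmark : Huybrechts_K3_marking_exists)
    (hS : IsK3Surface S)
    (hρ : ∀ e m : ℕ, 2 ≤ e → 3 ≤ m → e * m + Module.finrank ℂ ↥(algebraicClasses S 1) ≠ 22) :
    (∀ (f : complexBetti S (2 * 1) →ₗ[ℂ] complexBetti S (2 * 1)),
      (∀ y, IsRationalClass y → IsRationalClass (f y)) →
      (∀ (i j : ℕ) y, IsOfHodgeType 2 S (2 * 1) i j y → IsOfHodgeType 2 S (2 * 1) i j (f y)) →
      (∀ d ∈ algebraicClasses S 1, f d = 0) →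
      (∀ y : complexBetti S (2 * 1), ∀ d ∈ algebraicClasses S 1,
        cupProduct (rfl : 2 * 1 + 2 * 1 = 2 * 2) (f y) d = 0) →
      ∃ a : ℚ, ∀ y : complexBetti S (2 * 1),
        (∀ d ∈ algebraicClasses S 1, cupProduct (rfl : 2 * 1 + 2 * 1 = 2 * 2) y d = 0) →
          f y = (a : ℂ) • y) ∨
    HasComplexMultiplication S := by
  classical
  have hHT : Huybrechts_K3_hodgeTypes_H2 := Huybrechts_K3_hodgeTypes_H2_holds
  obtain ⟨η, p₀, x, hp₀, ⟨hp₀int, hp₀gen, hηint, hηcup, hx20, hx20'⟩, hxx, hxpos, hu⟩ := hmark S hS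
  set N := algebraicClasses S 1 with hNdef
  set σ := η.symm x with hσdef
  have hησ : η σ = x := by rw [hσdef, LinearEquiv.apply_symm_apply]
  have hxne : σ ≠ 0 := by
    intro h0
    have hx : x = 0 := by rw [← hησ, h0, map_zero]
    subst hx
    simp [k3Form] at hxpos
  obtain ⟨h₁, -, h₃⟩ := hHT S hS σ hx20 hxne
  have hσbar : conjClass (ComplexPoints S) (2 * 1) σ = η.symm (star x) := conjClass_marking_symm η hηint x
  have hsmul0 : ∀ {c : ℂ}, c • p₀ = 0 → c = 0 := fun h => by
    rcases smul_eq_zero.1 h with h | h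
    · exact h
    · exact absurd h hp₀
  have hL11 : ∀ c : complexBetti S (2 * 1), IsRationalClass c → IsOfHodgeType 2 S (2 * 1) 1 1 c → c ∈ N :=
    fun c hc h11 => lefschetzOneOne_rational_holds hS.1 c hc h11
  have hND : ∀ c ∈ N, IsRationalClass c →
      (∀ d ∈ N, cupProduct (rfl : 2 * 1 + 2 * 1 = 2 * 2) c d = 0) → c = 0 :=
    fun c hcN hc hperp => anchorExistence_cmFloor_divisorClass_eq_zero_of_hodgeIndex
      hodgeIndex_surface_holds lefschetzOneOne_rational_holds
      Grothendieck1969_supportedClasses_le_hodgeConiveau_holds hS hcN hc hperp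
  -- rational classes are `Λ_ℚ`
  have hrat : ∀ c, IsRationalClass c ↔ ∃ w : K3Index → ℚ, η c = fun i => (w i : ℂ) :=
    isRationalClass_iff_of_marking hS η hηint
  -- the rational points of `N`
  let NQ : Submodule ℚ (K3Index → ℚ) :=
    { carrier := {u | η.symm (fun j => (u j : ℂ)) ∈ N}
      add_mem' := fun {u v} hu hv => by
        simp only [Set.mem_setOf_eq, ratCastΛ_add, map_add]
        exact N.add_mem hu hv
      zero_mem' := by
        simp only [Set.mem_setOf_eq, ratCastΛ_zero, map_zero]
        exact N.zero_mem
      smul_mem' := fun q u hu => by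
        simp only [Set.mem_setOf_eq, ratCastΛ_smul, map_smul]
        exact N.smul_mem _ hu }
  have memNQ : ∀ u, u ∈ NQ ↔ η.symm (fun j => (u j : ℂ)) ∈ N := fun u => Iff.rfl
  -- `(1,1)`-classes through the marking
  have h11_iff : ∀ v : K3Index → ℂ, IsOfHodgeType 2 S (2 * 1) 1 1 (η.symm v) ↔
      (k3Form v x = 0 ∧ k3Form v (star x) = 0) := by
    intro v
    rw [h₃ (η.symm v), hηcup, hηcup, LinearEquiv.apply_symm_apply, hησ, hσbar, LinearEquiv.apply_symm_apply]
    constructor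
    · rintro ⟨ha, hb⟩
      exact ⟨hsmul0 ha, hsmul0 hb⟩
    · rintro ⟨ha, hb⟩
      rw [ha, hb, zero_smul]
      exact ⟨rfl, rfl⟩
  -- `N_ℚ = Λ_ℚ ∩ {x, x̄}^⊥`
  have hN : ∀ u : K3Index → ℚ, u ∈ NQ ↔
      (k3Form (fun i => (u i : ℂ)) x = 0 ∧ k3Form (fun i => (u i : ℂ)) (star x) = 0) := by
    intro u
    rw [memNQ, ← h11_iff]
    constructor
    · intro hu
      exact isOfHodgeType_of_mem_algebraicClasses_of_isSmoothProjective hS.1 1 hu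
    · intro hu
      exact hL11 _ ((hrat _).2 ⟨u, LinearEquiv.apply_symm_apply _ _⟩) hu
  -- `N` is spanned by its rational classes, so `N_ℚ^⊥ ⊗ ℂ ⊥ N`
  have hspan := span_isRationalClass_eq_top_of_isSmoothProjective_holds.supportedClasses_eq_span
    hS.1 (2 * 1) 1
  have horth : ∀ u ∈ k3FormRat.orthogonal NQ, ∀ d ∈ N, k3Form (fun j => (u j : ℂ)) (η d) = 0 := by
    intro u hu d hd
    rw [LinearMap.BilinForm.mem_orthogonal_iff] at hu
    have hd' : d ∈ Submodule.span ℂ {c : complexBetti S (2 * 1) |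
        IsRationalClass c ∧ c ∈ supportedClasses S (2 * 1) 1} := by
      rw [← hspan]; exact hd
    clear hd
    induction hd' using Submodule.span_induction with
    | mem d hd =>
      obtain ⟨w, hw⟩ := (hrat d).1 hd.1
      have hwN : w ∈ NQ := by
        rw [memNQ, ← hw, LinearEquiv.symm_apply_apply]
        exact hd.2
      rw [hw, k3Form_ratCast, k3FormRat_isSymm.eq, hu w hwN, Rat.cast_zero]
    | zero => rw [map_zero, k3Form_zero_right]
    | add c c' _ _ hc hc' => rw [map_add, k3Form_add_right, hc, hc', add_zero]
    | smul t c _ hc => rw [map_smul, k3Form_smul_right, hc, mul_zero]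
  -- `N_ℚ ∩ N_ℚ^⊥ = 0` (Hodge index)
  have hdisj : Disjoint NQ (k3FormRat.orthogonal NQ) := by
    rw [Submodule.disjoint_def]
    intro u huN huT
    have hc0 : η.symm (fun j => (u j : ℂ)) = 0 :=
      hND _ ((memNQ u).1 huN) ((hrat _).2 ⟨u, LinearEquiv.apply_symm_apply _ _⟩) fun d hd => by
        rw [hηcup, LinearEquiv.apply_symm_apply, horth u huT d hd, zero_smul]
    apply ratCastΛ_injective
    rw [ratCastΛ_zero]
    exact η.symm.injective (hc0.trans (map_zero _).symm)
  have hc := isCompl_orthogonal hdisj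
  -- the transcendental Hodge structure, irreducible of K3 type, polarized
  set H := hodgeT hN hdisj hxx hxpos with hH
  have hK3 : H.IsOfK3Type := isOfK3Type_hodgeT hN hdisj hxx hxpos
  have hirr : H.IsIrreducible := isIrreducible_hodgeT hN hdisj hxx hxpos
  set ψ : H.Polarization := polT hN hdisj hxx hxpos hu with hψ
  obtain ⟨hFld, ε, hεinj, hε⟩ := Zarhin1983_endAlg_isField_holds H hirr hK3
  -- `dim_ℚ N_ℚ = dim_ℂ N`, hence `dim_ℚ T = 22 - ρ(S)`
  let b := Module.finBasis ℚ NQ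
  let c : Fin (Module.finrank ℚ ↥NQ) → complexBetti S (2 * 1) :=
    fun i => η.symm (fun j => (((b i : NQ) : K3Index → ℚ) j : ℂ))
  have hcN : ∀ i, c i ∈ N := fun i => (memNQ _).1 (b i).2
  have hle : N ≤ Submodule.span ℂ (Set.range c) := by
    intro d hd
    have hd' : d ∈ Submodule.span ℂ {c : complexBetti S (2 * 1) |
        IsRationalClass c ∧ c ∈ supportedClasses S (2 * 1) 1} := by
      rw [← hspan]; exact hd
    refine Submodule.span_le.2 ?_ hd'
    rintro d ⟨hdQ, hdN⟩
    obtain ⟨w, hw⟩ := (hrat d).1 hdQ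
    have hwN : w ∈ NQ := by
      rw [memNQ, ← hw, LinearEquiv.symm_apply_apply]
      exact hdN
    have hd_eq : d = η.symm (fun j => (w j : ℂ)) := by rw [← hw, LinearEquiv.symm_apply_apply]
    have hw_eq : (w : K3Index → ℚ) = ∑ i, (b.repr ⟨w, hwN⟩ i) • ((b i : NQ) : K3Index → ℚ) := by
      have h := congrArg (fun t : NQ => (t : K3Index → ℚ)) (b.sum_repr ⟨w, hwN⟩).symm
      simpa only [Submodule.coe_sum, Submodule.coe_smul] using h
    rw [SetLike.mem_coe, hd_eq, hw_eq, ratCastΛ_sum, map_sum]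
    refine Submodule.sum_mem _ fun i _ => ?_
    rw [ratCastΛ_smul, map_smul]
    exact Submodule.smul_mem _ _ (Submodule.subset_span ⟨i, rfl⟩)
  haveI : Module.Finite ℂ ↥(Submodule.span ℂ (Set.range c)) :=
    Module.Finite.span_of_finite ℂ (Set.finite_range c)
  haveI : Module.Finite ℂ ↥N := Submodule.finiteDimensional_of_le hle
  have hdimN_le : Module.finrank ℂ ↥N ≤ Module.finrank ℚ ↥NQ :=
    (Submodule.finrank_mono hle).trans ((finrank_range_le_card c).trans (by simp))
  -- the rational basis vectors of `N_ℚ` stay independent over `ℂ` (`ι_{N_ℚ}` is injective)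
  have hcind : LinearIndependent ℂ c := by
    rw [Fintype.linearIndependent_iff]
    intro z hz i
    have hB := (Algebra.TensorProduct.basis ℂ b).linearIndependent
    rw [Fintype.linearIndependent_iff] at hB
    refine hB z ?_ i
    apply iota_injective NQ
    rw [map_sum, map_zero]
    have h := congrArg η hz
    rw [map_sum, map_zero] at h
    refine (Finset.sum_congr rfl fun j _ => ?_).trans h
    rw [map_smul, Algebra.TensorProduct.basis_apply, iota_one_tmul, map_smul, LinearEquiv.apply_symm_apply]
  have hdimN_ge : Module.finrank ℚ ↥NQ ≤ Module.finrank ℂ ↥N := by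
    let c' : Fin (Module.finrank ℚ ↥NQ) → ↥N := fun i => ⟨c i, hcN i⟩
    have hcomp : ⇑N.subtype ∘ c' = c := funext fun i => rfl
    have hc' : LinearIndependent ℂ c' := LinearIndependent.of_comp N.subtype (hcomp ▸ hcind)
    simpa using hc'.fintype_card_le_finrank
  have hdimN : Module.finrank ℚ ↥NQ = Module.finrank ℂ ↥N := le_antisymm hdimN_ge hdimN_le
  have hdimΛ : Module.finrank ℚ (K3Index → ℚ) = 22 := by
    rw [Module.finrank_fintype_fun_eq_card]
    simp [Fintype.card_sum, Fintype.card_fin]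
  have hdimT : ∀ e m : ℕ, 2 ≤ e → 3 ≤ m → e * m ≠ Module.finrank ℚ ↥(k3FormRat.orthogonal NQ) := by
    intro e m he hm hem
    have h := Submodule.finrank_add_eq_of_isCompl hc
    exact hρ e m he hm (by omega)
  -- van Geemen + Zarhin: `E = ℚ` or a non-real embedding
  rcases endAlg_eq_bot_or_exists_conj_ne_of_forall_mul_ne hirr hK3 ψ hFld hdimT with hbot | ⟨φ', a, hφ'a⟩
  · -- `E = ℚ`: every rational Hodge endomorphism of `H²(S)` killing `N¹` is a rational scalar on `T`
    refine Or.inl fun f hf_rat hf_typ _ _ => ?_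
    obtain ⟨φ, hφM, hφx, hφ11⟩ := anchorExistence_cmFloor_exists_ratEnd hHT hS η p₀ hp₀ hηint hηcup x hx20
      hx20' hxne f hf_rat hf_typ
    have hφT : ∀ t ∈ k3FormRat.orthogonal NQ, φ t ∈ k3FormRat.orthogonal NQ :=
      fun t ht => map_mem_T hN φ hφx ht
    have hmem : φ.restrict hφT ∈ H.endAlg := restrict_mem_endAlg hN hdisj hxx hxpos φ hφT hφx hφ11
    rw [hbot, Algebra.mem_bot] at hmem
    obtain ⟨a, ha⟩ := hmem
    refine ⟨a, fun y hy => ?_⟩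
    -- `η y ⊥ N_ℚ`, so `η y ∈ T_ℂ`
    have hzN : ∀ n ∈ NQ, k3Form (η y) (fun i => (n i : ℂ)) = 0 := by
      intro n hn
      have h := hy _ ((memNQ n).1 hn)
      rw [hηcup, LinearEquiv.apply_symm_apply] at h
      exact hsmul0 h
    have hz0 : cxEnd (NQ.projection _ hc) (η y) = 0 := cxEnd_projection_eq_zero hdisj hzN
    have hz : iota _ (lam hc (η y)) = η y := iota_lam_of_proj_eq_zero hc hz0
    have hφz : cxEnd φ (η y) = (a : ℂ) • η y := by
      conv_lhs => rw [← hz]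
      rw [← iota_baseChange_restrict φ hφT, ← ha, Algebra.algebraMap_eq_smul_one, LinearMap.baseChange_smul,
        LinearMap.smul_apply, Module.End.one_eq_id, LinearMap.baseChange_id, LinearMap.id_apply,
        ← AnchorExistenceCMFloor.ratCast_smul_eq, map_smul, hz]
    have hfy : f y = η.symm (cxEnd φ (η y)) := by
      rw [hφM, LinearMap.comp_apply, LinearMap.comp_apply, LinearEquiv.coe_coe, LinearEquiv.coe_coe,
        LinearEquiv.symm_apply_apply, LinearEquiv.symm_apply_apply]
    rw [hfy, hφz, map_smul, LinearEquiv.symm_apply_apply]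
  · -- CM: an element of `End_Hdg(T)` with a non-real eigenvalue on `ω`, extended by `id_N`
    right
    obtain ⟨hadjex, hadjconj⟩ := Zarhin1983_adjoint_eq_conj_holds H hirr hK3 ψ
    obtain ⟨a', ha'⟩ := hadjex a
    have hne : a' ≠ a := by
      intro h
      apply hφ'a
      have key := hadjconj a a' ha' φ'
      rw [h] at key
      exact key.symm
    set μ : ℂ := ε a with hμdef
    have hμ : μ.im ≠ 0 := by
      intro him
      apply hne
      apply hεinj
      have key := hadjconj a a' ha' ε.toRingHom
      change ε a' = starRingEnd ℂ (ε a) at key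
      rw [key, ← hμdef]
      exact Complex.conj_eq_iff_im.2 him
    -- the extension `û = a ⊕ id_N` and its eigenvalue on `x`
    have hamem : ((a : H.endAlg) : Module.End ℚ ↥(k3FormRat.orthogonal NQ)) ∈ H.endAlg := a.2
    set û : Module.End ℚ (K3Index → ℚ) := extendT hdisj (a : Module.End ℚ ↥(k3FormRat.orthogonal NQ)) with hû
    have hω : omega x hdisj ∈ H.piece 2 0 := (mem_piece_two_zero_ofPeriod _ _).2 ⟨1, one_smul _ _⟩
    have hûx : cxEnd û x = μ • x := by
      have h := hε a (omega x hdisj) hω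
      have h2 := congrArg (iota (k3FormRat.orthogonal NQ)) h
      rw [iota_baseChange hdisj, iota_omega hN hdisj, map_smul, iota_omega hN hdisj] at h2
      exact h2
    have hû11 : ∀ z : K3Index → ℂ, k3Form z x = 0 → k3Form z (star x) = 0 →
        k3Form (cxEnd û z) x = 0 ∧ k3Form (cxEnd û z) (star x) = 0 :=
      fun z hzx hzx' => k3Form_cxEnd_extendT hN hdisj hxx hxpos hamem hzx hzx'
    -- the endomorphism of `H²(S)`
    let Ψ : complexBetti S (2 * 1) →ₗ[ℂ] complexBetti S (2 * 1) :=
      η.symm.toLinearMap ∘ₗ cxEnd û ∘ₗ η.toLinearMap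
    have hΨapp : ∀ y, Ψ y = η.symm (cxEnd û (η y)) := fun y => rfl
    have hΨrat : ∀ y, IsRationalClass y → IsRationalClass (Ψ y) := by
      intro y hy
      obtain ⟨w, hw⟩ := (hrat y).1 hy
      rw [hΨapp, hw, cxEnd_ratCast]
      exact (hrat _).2 ⟨û w, LinearEquiv.apply_symm_apply _ _⟩
    have hΨσ : Ψ σ = μ • σ := by rw [hΨapp, hησ, hûx, map_smul]
    have hΨtyp : ∀ (i j : ℕ) y, IsOfHodgeType 2 S (2 * 1) i j y → IsOfHodgeType 2 S (2 * 1) i j (Ψ y) := by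
      refine typePreserving_of_lines hHT hS hx20 hxne Ψ ⟨μ, hΨσ⟩ ⟨star μ, ?_⟩ fun v hv => ?_
      · rw [hσbar, hΨapp, LinearEquiv.apply_symm_apply, cxEnd_star, hûx, star_smul, map_smul]
      · have hv' := hv
        rw [← LinearEquiv.symm_apply_apply η v, h11_iff] at hv'
        rw [hΨapp, h11_iff]
        exact hû11 (η v) hv'.1 hv'.2
    exact ⟨Ψ, hΨrat, hΨtyp, σ, μ, hx20, hxne, hμ, hΨσ⟩


end Summit.HodgeConjecture.HodgeConjecture.Theorems.MarkmanPartnerTransport.RealMultiplicationRanks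

end
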